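import Summits.Ventures.PercRepro.Night2T3Corank5

/-!
# PercRepro — the type-`3` balance is CONVEX in the coloop count: the level-tangent criterion
(night-2 gen 3, NIGHT-2-profile.md §1 Theorem J)

The definition of `J_3` rewritten: `(q + 1)·J_3(G) = (q + 2)·DF_3 + Σ_{S ∈ R_q(G)} ((q² − 1)·w_∞(S) − (q + 2))`
(`Jq_three_mul_succ_eq`), with `w_∞(S) = 1/(1 + m(S))` convex in the coloop count `m(S)`, so
`w_∞(S) ≥ 2t − t²·(1 + m(S))` for every `t` (`wInf_ge_tangent`).  Summing the tangent bound over the level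
`C_j = {S ∈ R_q(G) : |G ∖ S| = j}` with a level weight `t_j`, and using the per-level coloop count
`Σ_{S ∈ C_j} (1 + m(S)) = (|G| + 1 − j)·#C_j − (j + 1)·#C_{j+1}` (`sum_level_one_add_mTr`, from the double counting
`sum_card_sub_mTr_eq_succ_mul_card`), gives

**`Jq_three_nonneg_of_tangent`**: for ANY level weights `t : ℕ → ℚ`, on every rank-`q` set `G` with `|G| = q + d`,
`0 ≤ (q + 2)·DF_3 + Σ_{j ≤ d} [(q² − 1)·(2·t_j·#C_j − t_j²·((|G| + 1 − j)·#C_j − (j + 1)·#C_{j+1})) − (q + 2)·#C_j]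
  →  0 ≤ J_3(G)`.

The size form (`Jq_three_nonneg_of_split`) is the secant of `1/(1 + m)` through `m = q − 2` and `m = q`; the tangent
at a level's worst case is never weaker and keeps the finite-`q` surplus of the low-coloop sets (`3/(q − 2)` at
`m = q − 3`, `(q + 5)/(q − 3)` at `m = q − 4`).  No simplicity is needed for the criterion itself.
Imports `Night2T3Corank5` (the per-level double counting) only.
-/
namespace PercRepro.Star

open Finset ThmH SixFour GenQ

variable {α : Type*} [DecidableEq α] {M : Matroid α} [M.Finite]

/-! ## The tangent bound on the weight -/

/-- `w_∞(S) = 1/(1 + m(S)) ≥ 2t − t²·(1 + m(S))` for every `t` (`(t·(1 + m) − 1)² ≥ 0`). -/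
theorem wInf_ge_tangent (t : ℚ) (S : Finset α) :
    2 * t - t ^ 2 * (1 + (mTr M S : ℚ)) ≤ wInf M S := by
  unfold wInf
  have hpos : (0 : ℚ) < 1 + (mTr M S : ℚ) := by positivity
  rw [le_div_iff₀ hpos]
  nlinarith [sq_nonneg (t * (1 + (mTr M S : ℚ)) - 1)]

/-! ## The balance in tangent form -/

/-- `(q + 1)·J_3(G) = (q + 2)·DF_3 + Σ_{S ∈ R_q(G)} ((q² − 1)·w_∞(S) − (q + 2))` — the definition rewritten. -/
theorem Jq_three_mul_succ_eq (G : Finset α) (q : ℕ) :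
    ((q : ℚ) + 1) * Jq M G q 3 =
      ((q : ℚ) + 2) * (DFq M G q 3 : ℚ) +
        ∑ S ∈ Rq M G q, (((q : ℚ) ^ 2 - 1) * wInf M S - ((q : ℚ) + 2)) := by
  have hN : (Nq M G q : ℚ) = ∑ S ∈ Rq M G q, (1 : ℚ) := by
    unfold Nq
    rw [Finset.sum_const, nsmul_eq_mul, mul_one]
  have hR : ∑ S ∈ Rq M G q, (((q : ℚ) ^ 2 - 1) * wInf M S - ((q : ℚ) + 2)) =
      ((q : ℚ) ^ 2 - 1) * ∑ S ∈ Rq M G q, wInf M S - ((q : ℚ) + 2) * ∑ S ∈ Rq M G q, (1 : ℚ) := by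
    rw [Finset.sum_sub_distrib, Finset.mul_sum, Finset.mul_sum]
    simp only [mul_one]
  have hL : ∑ B ∈ Rq M G q, ((q : ℚ) + 2 - ((3 : ℕ) : ℚ)) * wInf M B =
      ((q : ℚ) - 1) * ∑ S ∈ Rq M G q, wInf M S := by
    rw [Finset.mul_sum]
    apply Finset.sum_congr rfl
    intro S _
    push_cast
    ring
  unfold Jq
  rw [hL, hR, hN]
  have hpos : (0 : ℚ) < (q : ℚ) + 1 := by positivity
  field_simp
  ring

/-! ## The per-level coloop count -/

/-- On the level `C_j`, `Σ_{S ∈ C_j} (1 + m(S)) = (|G| + 1 − j)·#C_j − (j + 1)·#C_{j+1}` (over `ℚ`). -/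
theorem sum_level_one_add_mTr {G : Finset α} {q : ℕ} (hG : G ⊆ gr M)
    (hrG : M.eRk (G : Set α) = (q : ℕ∞)) (j : ℕ) :
    ∑ S ∈ (Rq M G q).filter (fun S : Finset α => (G \ S).card = j), (1 + (mTr M S : ℚ)) =
      ((G.card : ℚ) + 1 - (j : ℚ)) *
          ((((Rq M G q).filter (fun S : Finset α => (G \ S).card = j)).card : ℕ) : ℚ) -
        ((j : ℚ) + 1) * ((((Rq M G q).filter (fun S : Finset α => (G \ S).card = j + 1)).card : ℕ) : ℚ) := by
  have hdc := sum_card_sub_mTr_eq_succ_mul_card hG hrG j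
  -- each `S ∈ C_j` has `|S| = |G| − j` and `m(S) ≤ |S|`
  have hcardS : ∀ S ∈ (Rq M G q).filter (fun S : Finset α => (G \ S).card = j),
      (S.card : ℚ) = (G.card : ℚ) - (j : ℚ) := by
    intro S hS
    have hS' := Finset.mem_filter.1 hS
    have hsub := (mem_Rq.1 hS'.1).1
    have hsd := Finset.card_sdiff_of_subset hsub
    have hle := Finset.card_le_card hsub
    rw [hS'.2] at hsd
    have : (j : ℚ) = (G.card : ℚ) - (S.card : ℚ) := by
      rw [hsd, Nat.cast_sub hle]
    linarith
  have hmle : ∀ S ∈ (Rq M G q).filter (fun S : Finset α => (G \ S).card = j), mTr M S ≤ S.card := by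
    intro S _
    exact Finset.card_le_card (coloopsOf_subset S)
  have hdcQ : ∑ S ∈ (Rq M G q).filter (fun S : Finset α => (G \ S).card = j), ((S.card : ℚ) - (mTr M S : ℚ)) =
      ((j : ℚ) + 1) * ((((Rq M G q).filter (fun S : Finset α => (G \ S).card = j + 1)).card : ℕ) : ℚ) := by
    have h := congrArg (fun z : ℕ => (z : ℚ)) hdc
    push_cast at h
    rw [← h]
    apply Finset.sum_congr rfl
    intro S hS
    push_cast [hmle S hS]
    ring
  have e1 : ∑ S ∈ (Rq M G q).filter (fun S : Finset α => (G \ S).card = j), (1 + (mTr M S : ℚ)) =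
      ∑ S ∈ (Rq M G q).filter (fun S : Finset α => (G \ S).card = j), ((1 : ℚ) + (S.card : ℚ)) -
        ∑ S ∈ (Rq M G q).filter (fun S : Finset α => (G \ S).card = j), ((S.card : ℚ) - (mTr M S : ℚ)) := by
    rw [← Finset.sum_sub_distrib]
    apply Finset.sum_congr rfl
    intro S _
    ring
  rw [e1, hdcQ, Finset.sum_congr rfl (fun S hS => by rw [hcardS S hS]), Finset.sum_const, nsmul_eq_mul]
  ring

/-! ## The level-tangent criterion -/

/-- **The level-tangent criterion**: for any level weights `t : ℕ → ℚ`, if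
`0 ≤ (q + 2)·DF_3 + Σ_{j ≤ d} [(q² − 1)·(2 t_j·#C_j − t_j²·((|G| + 1 − j)·#C_j − (j + 1)·#C_{j+1})) − (q + 2)·#C_j]`
on a rank-`q` set `G` with `|G| = q + d` (`1 ≤ q`), then `0 ≤ J_3(G)`. -/
theorem Jq_three_nonneg_of_tangent {G : Finset α} {q d : ℕ} (hG : G ⊆ gr M)
    (hrG : M.eRk (G : Set α) = (q : ℕ∞)) (hq : 1 ≤ q) (hcard : G.card = q + d) (t : ℕ → ℚ)
    (h : 0 ≤ ((q : ℚ) + 2) * (DFq M G q 3 : ℚ) +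
      ∑ j ∈ Finset.range (d + 1),
        (((q : ℚ) ^ 2 - 1) *
            (2 * t j * ((((Rq M G q).filter (fun S : Finset α => (G \ S).card = j)).card : ℕ) : ℚ) -
              t j ^ 2 * (((G.card : ℚ) + 1 - (j : ℚ)) *
                  ((((Rq M G q).filter (fun S : Finset α => (G \ S).card = j)).card : ℕ) : ℚ) -
                ((j : ℚ) + 1) *
                  ((((Rq M G q).filter (fun S : Finset α => (G \ S).card = j + 1)).card : ℕ) : ℚ))) -
          ((q : ℚ) + 2) * ((((Rq M G q).filter (fun S : Finset α => (G \ S).card = j)).card : ℕ) : ℚ))) :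
    0 ≤ Jq M G q 3 := by
  have hpos : (0 : ℚ) < (q : ℚ) + 1 := by positivity
  have hq1 : (0 : ℚ) ≤ (q : ℚ) ^ 2 - 1 := by
    have : (1 : ℚ) ≤ (q : ℚ) := by exact_mod_cast hq
    nlinarith
  suffices hmain : 0 ≤ ((q : ℚ) + 1) * Jq M G q 3 by
    exact le_of_mul_le_mul_left (by rw [mul_zero]; exact hmain) hpos
  rw [Jq_three_mul_succ_eq]
  -- every rank-`q` subset sits on a level `j ≤ d`
  have hjd : ∀ S ∈ Rq M G q, (G \ S).card ≤ d := by
    intro S hS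
    have hS' := mem_Rq.1 hS
    have hSq : q ≤ S.card := le_card_of_eRk_eq hS'.2
    rw [Finset.card_sdiff_of_subset hS'.1]
    omega
  -- the per-set tangent bound with the weight of the set's level
  have hterm : ∀ S ∈ Rq M G q,
      ((q : ℚ) ^ 2 - 1) * (2 * t (G \ S).card - t (G \ S).card ^ 2 * (1 + (mTr M S : ℚ))) - ((q : ℚ) + 2) ≤
        ((q : ℚ) ^ 2 - 1) * wInf M S - ((q : ℚ) + 2) := by
    intro S _
    have h1 := wInf_ge_tangent (M := M) (t (G \ S).card) S
    have h2 := mul_le_mul_of_nonneg_left h1 hq1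
    linarith
  have hsum := Finset.sum_le_sum hterm
  -- the tangent side split by levels
  have hsplit : ∑ S ∈ Rq M G q,
      (((q : ℚ) ^ 2 - 1) * (2 * t (G \ S).card - t (G \ S).card ^ 2 * (1 + (mTr M S : ℚ))) - ((q : ℚ) + 2)) =
      ∑ j ∈ Finset.range (d + 1),
        (((q : ℚ) ^ 2 - 1) *
            (2 * t j * ((((Rq M G q).filter (fun S : Finset α => (G \ S).card = j)).card : ℕ) : ℚ) -
              t j ^ 2 * (((G.card : ℚ) + 1 - (j : ℚ)) *
                  ((((Rq M G q).filter (fun S : Finset α => (G \ S).card = j)).card : ℕ) : ℚ) -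
                ((j : ℚ) + 1) *
                  ((((Rq M G q).filter (fun S : Finset α => (G \ S).card = j + 1)).card : ℕ) : ℚ))) -
          ((q : ℚ) + 2) * ((((Rq M G q).filter (fun S : Finset α => (G \ S).card = j)).card : ℕ) : ℚ)) := by
    rw [← Finset.sum_fiberwise_of_maps_to (s := Rq M G q) (t := Finset.range (d + 1))
      (g := fun S : Finset α => (G \ S).card) (fun S hS => Finset.mem_range.2 (by have := hjd S hS; omega))]
    apply Finset.sum_congr rfl
    intro j _
    have hlev := sum_level_one_add_mTr hG hrG j
    rw [Finset.sum_congr rfl (fun S hS => by rw [(Finset.mem_filter.1 hS).2])]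
    rw [Finset.sum_sub_distrib, Finset.sum_const, ← Finset.mul_sum, Finset.sum_sub_distrib, Finset.sum_const,
      ← Finset.mul_sum, hlev, nsmul_eq_mul, nsmul_eq_mul]
    ring
  linarith [hsum, hsplit, h]

end PercRepro.Star
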